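import Summits.BirchSwinnertonDyer.BirchSwinnertonDyer.Theorems.PrintCf2RamifiedOffTYZSquareSilenceTwoPrimesEven
import HarnessLib

/-!
# Crux `PrintCf2.RamifiedOffTYZOfFacts` (stmt-BirchSwinnertonDyer-20509), line `offtyz-v7`, LEAD cycle 13 (cruxlead-20509 g12):
# SECTOR-FREE SQUARE SILENCE FROM BLOCKWISE WITNESSES (every `k`, odd and even `n`) — the general form of `…SquareSilenceTwoPrimesEven`

THEOREMS ONLY (no `def`, no named fact, no `sorry`), `--supports stmt-BirchSwinnertonDyer-20509` (C⁺ = item 23431 and the residual 23432: the Layer-1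
square motion of the genus point).  In g7/g8's square formulae (`galPt_mul_self_P_eq_add`, `…_even`) every term carries the indicator
`ι_D(g) = [D ≡ 5,6 ∧ g(√−D) = √−D ∧ (g·g)^{g(D)} ≡ σ_D]` of some CM block `D ∣ n`; the transfer lemma of `…SquareSilenceTwoPrimesEven` (p732749) kills
`ι_D` for EVERY `g` as soon as the block has a WITNESS (an `L_D(i)`-trivial `e` with `e² ∈ Gal(ℍ′_n/H′_D)`, `e ∉ Gal(ℍ′_n/H_D)` — e.g. the Frobenius
element of a ramified odd prime `r ∣ D` whose Euler symbols relative to `D` are all `+1`, with (F5)), and g8's `chi_eq_zero_of_trivialOnL_of_cmBlockSpec`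
kills it whenever `g` is trivial on `L_D(i)` — automatic for the single-prime blocks `D = p`, `2p` when `g` fixes `i` (and `√−2`).  Hence, with NO
coefficient bookkeeping and no sector analysis:
* §2 `galPt_sq_genusPoint_eq_of_blockwise_even/odd`: if for every CM block either a witness exists or `g` is `L_D(i)`-trivial once it fixes `√−D`, then
  `g·g·P(n) = P(n)`;
* §3 `galPt_sq_genusPoint_eq_of_witnesses_even/odd`: if every CM block `D ∣ n` is `p`, `2p`, or carries a witness, then `g·g·P(n) = P(n)` for every `g`
  fixing `i` (and `√−2` for even `n`) — exactly the square hypothesis of g11's lower-half doors (p727254 / p729925).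
Coverage (LEAD census, instruments/census_wit.py): all 132 even two-prime jump-one members `n ≤ 16000` (= `…SquareSilenceTwoPrimesEven`); for `k = 3`
even the witness-everywhere condition holds on the `s = 5` members (e.g. `n = 42486 = 2·3·73·97`) but on none of the 246 `s = 3` members `≤ 10⁵` (a block
`2pq` with `p, q ≢ 1 (8)` has no Frobenius witness) — there the coefficient-aware / genus-regime route is needed (30 of 50 members `≤ 3·10⁴` are
display-provable that way, 13 need the ring-class law; crux workfile `Lines/offtyz_v7_EvenTwoPrimes.md`).  The odd form is consistent with TYZ: on the odd
`s = 1` families squares DO move, so witnesses cannot exist there.  BSD is not proved by any of this; no class is closed by this file.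

References: [cite: TianYuanZhang2017, §3.1 (p0011 L1–L13, L53–L73), Prop. 3.2 (1)(2), Thm. 3.6 (1)(2), proof of Lemma 3.21 (p0020 L27–L63)];
[cite: Cox2013, §5.C Lemma 5.19, (5.22), Cor. 5.21, §9.A]; tree: g7 `…MoverSquares`, g8 `…MoverSquaresSix`, `…MoverBlockCharacterSix`, g12
`…SquareSilenceTwoPrimesEven`.
-/

noncomputable section

open scoped Classical

open WeierstrassCurve WeierstrassCurve.Affine Finset Literature.NumberTheory.EllipticCurves
  Literature.NumberTheory.EllipticCurves.TianYuanZhang2017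
  Literature.NumberTheory.EllipticCurves.TianYuanZhang2017.W2
  Summit.BirchSwinnertonDyer.Rank1Residual.P2.GenusPeriodTransferLayer
  Summit.BirchSwinnertonDyer.Rank1Residual.P2
  Summit.BirchSwinnertonDyer.PrintCf2.MoverAssembly
  Summit.BirchSwinnertonDyer.PrintCf2.SquareSilenceEven

set_option autoImplicit false

namespace Summit.BirchSwinnertonDyer.PrintCf2.SquareSilenceWitnesses

variable {n : ℕ} (D : GenusPointData n)

/-! ## §1 Single-prime CM blocks are silent on the stabiliser of `i` (and `√−2`) -/

/-- An automorphism fixing `i` and `√−p` is trivial on `L_p(i)` for a PRIME block `p`. [cite: TianYuanZhang2017, proof of Lemma 3.21 (p0020 L55–L58)] -/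
theorem trivialOnL_prime_of_fix {p : ℕ} (hp : p.Prime) {g : D.H ≃ₐ[ℚ] D.H} (hgi : g D.im = D.im)
    (hgp : g (D.sqrtNeg p) = D.sqrtNeg p) : D.TrivialOnL p g := by
  refine ⟨hgi, fun d' hd' hd1 => ?_⟩
  rcases (Nat.dvd_prime hp).mp (Nat.dvd_of_mem_divisors hd') with rfl | rfl
  · omega
  · exact hgp

/-- An automorphism fixing `i`, `√−2` and `√−2p` is trivial on `L_{2p}(i)` for a block `2p`, `p` an odd prime (`2p ∣ n`).
[cite: TianYuanZhang2017, proof of Lemma 3.21 (p0020 L55–L58)] -/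
theorem trivialOnL_two_mul_prime_of_fix (hsq : Squarefree n) {p : ℕ} (hp : p.Prime) (hp2 : p ≠ 2) (h2p : 2 * p ∈ n.divisors)
    {g : D.H ≃ₐ[ℚ] D.H} (hgi : g D.im = D.im) (hg2 : g (D.sqrtNeg 2) = D.sqrtNeg 2)
    (hg2p : g (D.sqrtNeg (2 * p)) = D.sqrtNeg (2 * p)) : D.TrivialOnL (2 * p) g := by
  have hn0 : n ≠ 0 := hsq.ne_zero
  have h2pd : 2 * p ∣ n := Nat.dvd_of_mem_divisors h2p
  have h2 : 2 ∈ n.divisors := Nat.mem_divisors.mpr ⟨(Dvd.intro p rfl).trans h2pd, hn0⟩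
  have hpm : p ∈ n.divisors := Nat.mem_divisors.mpr ⟨(Dvd.intro_left 2 rfl).trans h2pd, hn0⟩
  have hgp : g (D.sqrtNeg p) = D.sqrtNeg p := apply_sqrtNeg_eq_of_mul D h2 hpm h2p hgi hg2 hg2p
  refine ⟨hgi, fun d' hd' hd1 => ?_⟩
  have hdvd : d' ∣ 2 * p := Nat.dvd_of_mem_divisors hd'
  rcases (ThetaDescent.dvd_prime_mul_prime_iff Nat.prime_two hp).mp hdvd with rfl | rfl | rfl | rfl
  · omega
  · exact hg2
  · exact hgp
  · exact hg2p

/-! ## §2 Blockwise silence: a witness on every CM block that the given `g` could move -/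

/-- **BLOCKWISE SQUARE SILENCE, even `n ≡ 6 (mod 8)`.**  `n` square-free; the displayed recursion and CM-point layer on every block; an automorphism
`g` of `ℍ′_n` such that for EVERY block `D ∣ n`, `D ≡ 5, 6 (mod 8)`, `D > 1`: EITHER some `L_D(i)`-trivial `e` has `e·e ∈ Gal(ℍ′_n/H′_D)` and
`e ∉ Gal(ℍ′_n/H_D)` (a witness: then NO square moves on the block, `…SquareSilenceEven.not_sqChi_of_trivialOnL_involution`), OR `g` itself is trivial
on `L_D(i)` as soon as it fixes `√−D` (then `g·g` does not move on the block, g8's `chi_eq_zero_of_trivialOnL_of_cmBlockSpec`).  Then `g·g·P(n) = P(n)`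
(every block motion in g8's square formula vanishes; no coefficient is used).
[cite: TianYuanZhang2017, §3.1 (p0011 L1–L13, L53–L73), Prop. 3.2 (1)(2), Thm. 3.6 (1)(2), proof of Lemma 3.21 (p0020 L27–L63)] -/
theorem galPt_sq_genusPoint_eq_of_blockwise_even (hsq : Squarefree n) (h6 : n % 8 = 6) (hrec : D.recursion)
    (z : ℕ → APoint D.H) (Φ : ℕ → Finset (D.H ≃ₐ[ℚ] D.H)) (ΓH ΓH' : ℕ → Subgroup (D.H ≃ₐ[ℚ] D.H))
    (σ : ℕ → (D.H ≃ₐ[ℚ] D.H)) (c : D.H ≃ₐ[ℚ] D.H) (hc : D.ConjSpec c)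
    (hblock : ∀ d ∈ n.divisors, ((d % 8 = 5 ∨ d % 8 = 6) → D.CMBlockSpec d (z d) (Φ d) (ΓH d) (ΓH' d) (σ d) c) ∧
      (d % 8 = 7 → D.SevenBlockSpec d))
    (g : D.H ≃ₐ[ℚ] D.H)
    (hsil : ∀ d ∈ n.divisors, (d % 8 = 5 ∨ d % 8 = 6) → 1 < d →
      (∃ e : D.H ≃ₐ[ℚ] D.H, D.TrivialOnL d e ∧ e * e ∈ ΓH' d ∧ e ∉ ΓH d) ∨ (g (D.sqrtNeg d) = D.sqrtNeg d → D.TrivialOnL d g)) :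
    D.galPt (g * g) (D.P n) = D.P n := by
  have hdvd_of_rec : ∀ {d d' : ℕ}, d' ∈ recursionIndex d → d' ∣ d := fun hd' =>
    Nat.dvd_of_mem_divisors (Finset.mem_filter.mp hd').1
  have hmem : ∀ {d : ℕ}, d ∣ n → d ∈ n.divisors := fun hd => Nat.mem_divisors.mpr ⟨hd, hsq.ne_zero⟩
  -- every block indicator vanishes
  have hι : ∀ d ∈ n.divisors, ¬ ((d % 8 = 5 ∨ d % 8 = 6) ∧ g (D.sqrtNeg d) = D.sqrtNeg d ∧ (g * g) ^ gK d * (σ d)⁻¹ ∈ ΓH' d) := by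
    rintro d hd ⟨h56, hfix, hχ⟩
    have hd1 : 1 < d := by rcases h56 with h | h <;> omega
    rcases hsil d hd h56 hd1 with ⟨e, heL, hee, heH⟩ | htriv
    · exact not_sqChi_of_trivialOnL_involution D hd hd1 ((hblock d hd).1 h56) heL hee heH g hχ
    · exact chi_eq_zero_of_trivialOnL_of_cmBlockSpec D hd1 ((hblock d hd).1 h56) (htriv hfix) hχ
  rw [galPt_mul_self_P_eq_add_even D hsq h6 hrec z Φ ΓH ΓH' σ c hc hblock g]
  have hnn : n ∈ n.divisors := Nat.mem_divisors_self n hsq.ne_zero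
  rw [if_neg (hι n hnn)]
  have h1 : ∑ d ∈ recursionIndex n, (D.scriptL (n / d)).natAbs *
      (if (d % 8 = 5 ∨ d % 8 = 6) ∧ g (D.sqrtNeg d) = D.sqrtNeg d ∧ (g * g) ^ gK d * (σ d)⁻¹ ∈ ΓH' d then 1 else 0) = 0 :=
    Finset.sum_eq_zero fun d hd => by rw [if_neg (hι d (hmem (hdvd_of_rec hd))), mul_zero]
  have h2 : ∑ d ∈ recursionIndex n, ∑ d' ∈ (recursionIndex d).filter (fun d' => d' % 8 = 5),
      (D.scriptL (n / d)).natAbs * (D.scriptL (d / d')).natAbs *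
        (if (d' % 8 = 5 ∨ d' % 8 = 6) ∧ g (D.sqrtNeg d') = D.sqrtNeg d' ∧ (g * g) ^ gK d' * (σ d')⁻¹ ∈ ΓH' d' then 1 else 0) = 0 :=
    Finset.sum_eq_zero fun d hd => Finset.sum_eq_zero fun d' hd' => by
      rw [if_neg (hι d' (hmem ((hdvd_of_rec (Finset.mem_filter.mp hd').1).trans (hdvd_of_rec hd)))), mul_zero]
  have h3 : ∑ d ∈ (recursionIndex n).filter (fun d => d % 2 = 0), ∑ d' ∈ recursionIndex d,
      ∑ e ∈ (recursionIndex d').filter (fun e => e % 8 = 5),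
        (D.scriptL (n / d)).natAbs * (D.scriptL (d / d')).natAbs * (D.scriptL (d' / e)).natAbs *
          (if (e % 8 = 5 ∨ e % 8 = 6) ∧ g (D.sqrtNeg e) = D.sqrtNeg e ∧ (g * g) ^ gK e * (σ e)⁻¹ ∈ ΓH' e then 1 else 0) = 0 :=
    Finset.sum_eq_zero fun d hd => Finset.sum_eq_zero fun d' hd' => Finset.sum_eq_zero fun e he => by
      rw [if_neg (hι e (hmem (((hdvd_of_rec (Finset.mem_filter.mp he).1).trans (hdvd_of_rec hd')).trans
        (hdvd_of_rec (Finset.mem_filter.mp hd).1)))), mul_zero]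
  rw [h1, h2, h3, add_zero, add_zero, add_zero, zero_smul, add_zero]

/-- **BLOCKWISE SQUARE SILENCE, odd `n ≡ 5, 7 (mod 8)`** (g7's square formula `galPt_mul_self_P_eq_add`; same alternative per block `D ≡ 5 (mod 8)`).
[cite: TianYuanZhang2017, §3.1 (p0011 L1–L13, L53–L73), Prop. 3.2 (1), Thm. 3.6 (1), proof of Lemma 3.21 (p0020 L27–L63)] -/
theorem galPt_sq_genusPoint_eq_of_blockwise_odd (hsq : Squarefree n) (h57 : n % 8 = 5 ∨ n % 8 = 7) (hrec : D.recursion)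
    (z : ℕ → APoint D.H) (Φ : ℕ → Finset (D.H ≃ₐ[ℚ] D.H)) (ΓH ΓH' : ℕ → Subgroup (D.H ≃ₐ[ℚ] D.H))
    (σ : ℕ → (D.H ≃ₐ[ℚ] D.H)) (c : D.H ≃ₐ[ℚ] D.H) (hc : D.ConjSpec c)
    (hblock : ∀ d ∈ n.divisors, ((d % 8 = 5 ∨ d % 8 = 6) → D.CMBlockSpec d (z d) (Φ d) (ΓH d) (ΓH' d) (σ d) c) ∧
      (d % 8 = 7 → D.SevenBlockSpec d))
    (g : D.H ≃ₐ[ℚ] D.H)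
    (hsil : ∀ d ∈ n.divisors, d % 8 = 5 → 1 < d →
      (∃ e : D.H ≃ₐ[ℚ] D.H, D.TrivialOnL d e ∧ e * e ∈ ΓH' d ∧ e ∉ ΓH d) ∨ (g (D.sqrtNeg d) = D.sqrtNeg d → D.TrivialOnL d g)) :
    D.galPt (g * g) (D.P n) = D.P n := by
  have hdvd_of_rec : ∀ {d d' : ℕ}, d' ∈ recursionIndex d → d' ∣ d := fun hd' =>
    Nat.dvd_of_mem_divisors (Finset.mem_filter.mp hd').1
  have hmem : ∀ {d : ℕ}, d ∣ n → d ∈ n.divisors := fun hd => Nat.mem_divisors.mpr ⟨hd, hsq.ne_zero⟩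
  have hι : ∀ d ∈ n.divisors, ¬ (d % 8 = 5 ∧ g (D.sqrtNeg d) = D.sqrtNeg d ∧ (g * g) ^ gK d * (σ d)⁻¹ ∈ ΓH' d) := by
    rintro d hd ⟨h5, hfix, hχ⟩
    have hd1 : 1 < d := by omega
    rcases hsil d hd h5 hd1 with ⟨e, heL, hee, heH⟩ | htriv
    · exact not_sqChi_of_trivialOnL_involution D hd hd1 ((hblock d hd).1 (Or.inl h5)) heL hee heH g hχ
    · exact chi_eq_zero_of_trivialOnL_of_cmBlockSpec D hd1 ((hblock d hd).1 (Or.inl h5)) (htriv hfix) hχ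
  rw [galPt_mul_self_P_eq_add D hsq h57 hrec z Φ ΓH ΓH' σ c hc hblock g]
  have hnn : n ∈ n.divisors := Nat.mem_divisors_self n hsq.ne_zero
  rw [if_neg (hι n hnn)]
  have h1 : ∑ d ∈ recursionIndex n, (D.scriptL (n / d)).natAbs *
      (if d % 8 = 5 ∧ g (D.sqrtNeg d) = D.sqrtNeg d ∧ (g * g) ^ gK d * (σ d)⁻¹ ∈ ΓH' d then 1 else 0) = 0 :=
    Finset.sum_eq_zero fun d hd => by rw [if_neg (hι d (hmem (hdvd_of_rec hd))), mul_zero]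
  rw [h1, add_zero, zero_smul, add_zero]

/-! ## §3 On the stabiliser of `i, √−2`: only the CM blocks with two odd primes need a witness -/

/-- **SQUARE SILENCE ON THE STABILISER from witnesses on the composite blocks** (even `n ≡ 6 (mod 8)`): if every block `D ∣ n`, `D ≡ 5, 6 (mod 8)`,
is a prime `p`, or `2p` with `p` prime, or carries a witness, then `g·g·P(n) = P(n)` for every `g` fixing `i` and `√−2` (the blocks `p`, `2p` are silent
under such `g` by §1).  The sector-free form of `…SquareSilenceTwoPrimesEven` (there: `n = 2lq`, ONE composite block, the top one).
[cite: TianYuanZhang2017, §3.1 (p0011 L1–L13, L53–L73), Prop. 3.2 (1)(2), Thm. 3.6 (1)(2), proof of Lemma 3.21 (p0020 L27–L63)] -/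
theorem galPt_sq_genusPoint_eq_of_witnesses_even (hsq : Squarefree n) (h6 : n % 8 = 6) (hrec : D.recursion)
    (z : ℕ → APoint D.H) (Φ : ℕ → Finset (D.H ≃ₐ[ℚ] D.H)) (ΓH ΓH' : ℕ → Subgroup (D.H ≃ₐ[ℚ] D.H))
    (σ : ℕ → (D.H ≃ₐ[ℚ] D.H)) (c : D.H ≃ₐ[ℚ] D.H) (hc : D.ConjSpec c)
    (hblock : ∀ d ∈ n.divisors, ((d % 8 = 5 ∨ d % 8 = 6) → D.CMBlockSpec d (z d) (Φ d) (ΓH d) (ΓH' d) (σ d) c) ∧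
      (d % 8 = 7 → D.SevenBlockSpec d))
    (hwit : ∀ d ∈ n.divisors, (d % 8 = 5 ∨ d % 8 = 6) → 1 < d →
      d.Prime ∨ (∃ p : ℕ, p.Prime ∧ d = 2 * p) ∨ (∃ e : D.H ≃ₐ[ℚ] D.H, D.TrivialOnL d e ∧ e * e ∈ ΓH' d ∧ e ∉ ΓH d))
    (g : D.H ≃ₐ[ℚ] D.H) (hgi : g D.im = D.im) (hg2 : g (D.sqrtNeg 2) = D.sqrtNeg 2) :
    D.galPt (g * g) (D.P n) = D.P n := by
  refine galPt_sq_genusPoint_eq_of_blockwise_even D hsq h6 hrec z Φ ΓH ΓH' σ c hc hblock g fun d hd h56 hd1 => ?_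
  rcases hwit d hd h56 hd1 with hp | ⟨p, hp, rfl⟩ | hw
  · exact Or.inr fun hfix => trivialOnL_prime_of_fix D hp hgi hfix
  · refine Or.inr fun hfix => trivialOnL_two_mul_prime_of_fix D hsq hp ?_ hd hgi hg2 hfix
    rintro rfl; rcases h56 with h | h <;> omega
  · exact Or.inl hw

/-- **SQUARE SILENCE ON THE STABILISER from witnesses on the composite blocks** (odd `n ≡ 5, 7 (mod 8)`; `g` fixing `i`).
[cite: TianYuanZhang2017, §3.1 (p0011 L1–L13, L53–L73), Prop. 3.2 (1), Thm. 3.6 (1), proof of Lemma 3.21 (p0020 L27–L63)] -/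
theorem galPt_sq_genusPoint_eq_of_witnesses_odd (hsq : Squarefree n) (h57 : n % 8 = 5 ∨ n % 8 = 7) (hrec : D.recursion)
    (z : ℕ → APoint D.H) (Φ : ℕ → Finset (D.H ≃ₐ[ℚ] D.H)) (ΓH ΓH' : ℕ → Subgroup (D.H ≃ₐ[ℚ] D.H))
    (σ : ℕ → (D.H ≃ₐ[ℚ] D.H)) (c : D.H ≃ₐ[ℚ] D.H) (hc : D.ConjSpec c)
    (hblock : ∀ d ∈ n.divisors, ((d % 8 = 5 ∨ d % 8 = 6) → D.CMBlockSpec d (z d) (Φ d) (ΓH d) (ΓH' d) (σ d) c) ∧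
      (d % 8 = 7 → D.SevenBlockSpec d))
    (hwit : ∀ d ∈ n.divisors, d % 8 = 5 → 1 < d →
      d.Prime ∨ (∃ e : D.H ≃ₐ[ℚ] D.H, D.TrivialOnL d e ∧ e * e ∈ ΓH' d ∧ e ∉ ΓH d))
    (g : D.H ≃ₐ[ℚ] D.H) (hgi : g D.im = D.im) : D.galPt (g * g) (D.P n) = D.P n := by
  refine galPt_sq_genusPoint_eq_of_blockwise_odd D hsq h57 hrec z Φ ΓH ΓH' σ c hc hblock g fun d hd h5 hd1 => ?_
  rcases hwit d hd h5 hd1 with hp | hw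
  · exact Or.inr fun hfix => trivialOnL_prime_of_fix D hp hgi hfix
  · exact Or.inl hw

end Summit.BirchSwinnertonDyer.PrintCf2.SquareSilenceWitnesses

end
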